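import Mathlib
import HarnessLib
import Summits.HubbardSuperconductivity.HubbardSuperconductivity.Theorems.KLProgrammeKLRegimeEnginePairTransferBudgetExplicitThreeTerm

/-!
# Route `KLProgramme` — ENGINE child gen 8 (stmt-HubbardSuperconductivity-20437 `KLRegimeEngineV17F2`), skeleton v2 class #5 rev 3, (X).3 BUDGET ARITHMETIC:
# the SCALAR rows (B2)/(B3) of row 87 FROM SIZE HYPOTHESES — `klbd_scalarRow_direct_of_sizes`, `klbd_scalarRow_crossed_of_sizes` (+ the `n = 0` rows)
# (cell gate-hubbard-kl, seat hubbard-kl-k3c1-p1 g16; row 89 of CLASS5-RESOLVED-STEP.md §13 / KLTC-INDEX v12)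

WHY.  Row 87 (`pairTransferStep7_of_analytic_resolved_budgetGridSplit`, p656995) splits the ONE budget row of the (X).3 producer at the pen's share `φ = 1/2`
(cell STATUS (R243)) and scalarises its explicit side into (B2) `c_d ≤ ½·θ·(3/5)·Pref·(Klam U)²·ms`, (B3) `c_x ≤ …`, (B4) `T₀ ≤ …`, where `c_d`, `c_x` are the
coefficients of the ROOM's two `min` profiles in the explicit number `TT` (row 82's `klbd_explicit_le_threeTerm`, verbatim):
`c_d = M4²·[1 ≤ n ∧ n+2 ≤ j′]·(512/3)·K′·72G² + (η4M4 + M4η4)·[n ≠ 0]·(512/3)·K·16384G²`, `K = (27/8π²)·A2s·(16/π)·(10 + 50Gβ/L)`, `K′ = K·(Λ_{j′}/Λₙ)`,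
`G = 4 + (8/3)·Gfr₁·U²` (crossed: `256/3`, `338`, guard `… ∧ n+3 ≤ n_β`).  THIS FILE discharges (B2) and (B3) from SIZE hypotheses in the natural currencies of their
owners — `M4 ≤ c₄·U` (class #1's 4-point sup), `η4 ≤ e₄·U·(Λₙ₊₁·klIdxMass (n+1) j′)` (the LEADING currency `κD²` of the grid row `klmg_kernelDiff4_le_gridBinomial₂`),
the loop's `Gfr₁·U² ≤ 1` and `8Gβ ≤ L` (as derived in row 86's proof) — against ONE explicit threshold row each:
(B2) ⟸ `A2s·(1156·c₄² + 2²⁸·4⁻ⁿ·e₄c₄) ≤ (9/20)·θ·r·Klam²`;  (B3) ⟸ `A2s·(2712·c₄² + 2²⁷·4⁻ⁿ·e₄c₄) ≤ (9/20)·θ·r·Klam²`  (every `n ≥ 1`, every `j′ ≥ n+1`,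
uniformly: the decay of `K′` and of `κD²` in `j′ − n` is exactly `ms = klIdxMass n j′ = 15367·4^{−(j′−n)}`); at `n = 0` both coefficients vanish
(`klbd_scalarRow_direct_zero`, `klbd_scalarRow_crossed_zero`).  The thresholds are what the (X).3 closer must grant: against `r ≤ klCTcap7 = 2²⁰` they need a NUMERIC
two-shell constant `A2s` (located «(X).3-KLTS-NUMERIC», CLASS5-RESOLVED-STEP.md §13) and the U-order of `e₄` (located «(X).3-ETA-CURRENCY»).
Pure real arithmetic; nothing about the model's sizes is asserted; nothing asserts (X).3, (c), K3 or superconductivity.  0 kit · 0 lit.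
-/

noncomputable section

namespace Summit.HubbardSuperconductivity.HubbardSuperconductivity.Theorems.KLRegimeSplit

set_option linter.dupNamespace false -- summit = problem name (single-conjunct summit), D-0017

open Finset Literature.MathematicalPhysics.QuantumLattice Literature.Probability.LatticeModels
open Summit.HubbardSuperconductivity.HubbardSuperconductivity.Theorems.KLProgrammeLegKernels
open Summit.HubbardSuperconductivity.HubbardSuperconductivity.Theorems.DispersionFlow
open Summit.HubbardSuperconductivity.HubbardSuperconductivity.Theorems.EngineV8

section ScalarRows

/-! ## §1 Arithmetic of the index weights and the regime numbers -/

/-- `Λ_{j′}/Λₙ = ms/15367` (`ms = klIdxMass n j′`) for `n ≤ j′` (over `klth_klScale_div_klScale`). -/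
theorem klbd_klScale_div_eq_klIdxMass {n j' : ℕ} (h : n ≤ j') : klScale klE0 j' / klScale klE0 n = klIdxMass n j' / 15367 := by
  rw [klth_klScale_div_klScale h]; unfold klIdxMass; ring

/-- **The D-line Gram currency in index-mass units**: `Λₙ₊₁·klIdxMass (n+1) j′ = klIdxMass n j′·4⁻ⁿ/32` for `n+1 ≤ j′`. -/
theorem klbd_kappaD_sq_eq {n j' : ℕ} (h : n + 1 ≤ j') : klScale klE0 (n + 1) * klIdxMass (n + 1) j' = klIdxMass n j' * ((4 : ℝ) ^ n)⁻¹ / 32 := by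
  unfold klScale klE0 klIdxMass
  obtain ⟨d, rfl⟩ := Nat.exists_eq_add_of_le h
  rw [Nat.add_sub_cancel_left, show n + 1 + d - n = d + 1 by omega, pow_add, pow_add, pow_one]
  have h4 : (0 : ℝ) < 4 ^ n := by positivity
  have h4d : (0 : ℝ) < 4 ^ d := by positivity
  field_simp

/-- `(3/2)·r ≤ klIdxPrefactor r (n+1)` (`0 ≤ r`). -/
theorem klbd_three_halves_le_klIdxPrefactor_succ {r : ℝ} (hr : 0 ≤ r) (n : ℕ) : 3 / 2 * r ≤ klIdxPrefactor r (n + 1) := by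
  unfold klIdxPrefactor
  have h : ((2 : ℝ) ^ (n + 1))⁻¹ ≤ 2⁻¹ := by
    apply inv_anti₀ (by norm_num)
    calc (2 : ℝ) = 2 ^ 1 := by norm_num
      _ ≤ 2 ^ (n + 1) := pow_le_pow_right₀ (by norm_num) (by omega)
  nlinarith

/-- The angular numeral `(27/(8π²))·(16/π) ≤ 2` (`π ≥ 3`). -/
theorem klbd_angular_numeral_le_two : 27 / (8 * Real.pi ^ 2) * (16 / Real.pi) ≤ 2 := by
  have hπ : (3 : ℝ) ≤ Real.pi := Real.pi_gt_three.le
  have hπ0 : (0 : ℝ) < Real.pi := Real.pi_pos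
  rw [div_mul_div_comm, div_le_iff₀ (by positivity)]
  nlinarith [mul_le_mul hπ (mul_le_mul hπ hπ (by norm_num) hπ0.le) (by norm_num) hπ0.le]

/-- The regime numbers of the explicit side: `G = 4 + (8/3)Gfr₁U² ∈ [4, 20/3]` (from `Gfr₁U² ≤ 1`) and `10 + 50Gβ/L ≤ 65/4` (from `8Gβ ≤ L`). -/
theorem klbd_regime_numbers {Gfr U β : ℝ} {L : ℕ} [NeZero L] (hGfr : 0 ≤ Gfr) (hGU : Gfr * U ^ 2 ≤ 1)
    (hGL : 8 * (4 + 8 / 3 * Gfr * U ^ 2) * β ≤ L) :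
    4 ≤ 4 + 8 / 3 * Gfr * U ^ 2 ∧ 4 + 8 / 3 * Gfr * U ^ 2 ≤ 20 / 3 ∧ 10 + 50 * (4 + 8 / 3 * Gfr * U ^ 2) * β / L ≤ 65 / 4 := by
  have hL0 : (0 : ℝ) < L := Nat.cast_pos.2 (Nat.pos_of_ne_zero (NeZero.ne L))
  have h0 : 0 ≤ Gfr * U ^ 2 := mul_nonneg hGfr (sq_nonneg U)
  refine ⟨by nlinarith, by nlinarith, ?_⟩
  have h1 : 50 * (4 + 8 / 3 * Gfr * U ^ 2) * β / L ≤ 25 / 4 := by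
    rw [div_le_iff₀ hL0]; nlinarith
  linarith

/-! ## §2 (B2): the direct channel -/

set_option maxHeartbeats 800000 in -- two guarded products bounded factor by factor, then a linear assembly
/-- **`klbd_scalarRow_direct_of_sizes`** — row 87's scalar row (B2) from the size hypotheses `M4 ≤ c₄U`, `η4 ≤ e₄·U·(Λₙ₊₁·klIdxMass (n+1) j′)`, the regime numbers
`Gfr₁U² ≤ 1`, `8Gβ ≤ L`, and ONE threshold row `A2s·(1156·c₄² + 2²⁸·4⁻ⁿ·e₄c₄) ≤ (9/20)·θ·r·Klam²` (every `1 ≤ n`, `n+1 ≤ j′`; the statement's left side is (B2)'s, verbatim). -/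
theorem klbd_scalarRow_direct_of_sizes (P : SplitConsts) (R : RenConsts) (hGfr : 0 ≤ R.Gfr 1) {A2s M4 η4 U β θ r c₄ e₄ : ℝ} {L : ℕ} [NeZero L] {n j' : ℕ}
    (hn : 1 ≤ n) (hj : n + 1 ≤ j') (hA2s : 0 ≤ A2s) (hU : 0 ≤ U) (hβ : 0 ≤ β) (hθ : 0 ≤ θ) (hr : 0 ≤ r) (hc₄ : 0 ≤ c₄) (he₄ : 0 ≤ e₄)
    (hM4 : 0 ≤ M4) (hM4c : M4 ≤ c₄ * U) (hη4 : 0 ≤ η4) (hη4e : η4 ≤ e₄ * U * (klScale klE0 (n + 1) * klIdxMass (n + 1) j'))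
    (hGU : R.Gfr 1 * U ^ 2 ≤ 1) (hGL : 8 * (4 + 8 / 3 * R.Gfr 1 * U ^ 2) * β ≤ L)
    (hth : A2s * (1156 * c₄ ^ 2 + 2 ^ 28 * ((4 : ℝ) ^ n)⁻¹ * (e₄ * c₄)) ≤ 9 / 20 * (θ * (r * P.Klam ^ 2))) :
    (M4 * M4 * (if 1 ≤ n ∧ n + 2 ≤ j' then 512 / 3 * (27 / (8 * Real.pi ^ 2)) * A2s * (16 * (klScale klE0 j' / klScale klE0 n)) / Real.pi * (10 + 50 * (4 + 8 / 3 * R.Gfr 1 * U ^ 2) * β / L) * (72 * (4 + 8 / 3 * R.Gfr 1 * U ^ 2) ^ 2) else 0) + (η4 * M4 + M4 * η4) * (if n = 0 then (0 : ℝ) else 512 / 3 * (27 / (8 * Real.pi ^ 2)) * A2s * (16 / Real.pi) * (10 + 50 * (4 + 8 / 3 * R.Gfr 1 * U ^ 2) * β / L) * (16384 * (4 + 8 / 3 * R.Gfr 1 * U ^ 2) ^ 2))) ≤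
      2⁻¹ * (θ * (3 / 5 * (klIdxPrefactor r (n + 1) * ((P.Klam * U) ^ 2 * klIdxMass n j')))) := by
  obtain ⟨hG4, hG, hB⟩ := klbd_regime_numbers hGfr hGU hGL
  set G : ℝ := 4 + 8 / 3 * R.Gfr 1 * U ^ 2 with hGdef
  set B : ℝ := 10 + 50 * G * β / L with hBdef
  set ms : ℝ := klIdxMass n j' with hms
  have hms0 : 0 ≤ ms := klIdxMass_nonneg n j'
  have hκ := klbd_angular_numeral_le_two
  have hπ0 : (0 : ℝ) < Real.pi := Real.pi_pos
  have hκ0 : 0 ≤ 27 / (8 * Real.pi ^ 2) * (16 / Real.pi) := by positivity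
  have hG0 : 0 ≤ G := by linarith
  have hB0 : 0 ≤ B := by
    have hL0 : (0 : ℝ) ≤ L := Nat.cast_nonneg L
    have : 0 ≤ 50 * G * β / L := by positivity
    rw [hBdef]; linarith
  have hG2 : G ^ 2 ≤ (20 / 3) ^ 2 := pow_le_pow_left₀ hG0 hG 2
  have hratio : klScale klE0 j' / klScale klE0 n = ms / 15367 := klbd_klScale_div_eq_klIdxMass (by omega)
  have hκD : klScale klE0 (n + 1) * klIdxMass (n + 1) j' = ms * ((4 : ℝ) ^ n)⁻¹ / 32 := klbd_kappaD_sq_eq hj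
  have h4n : 0 ≤ ((4 : ℝ) ^ n)⁻¹ := by positivity
  rw [hκD] at hη4e
  -- the `M4²` term (D-line `min`-slot coefficient; present only in the interior)
  have hT1 : M4 * M4 * (if 1 ≤ n ∧ n + 2 ≤ j' then 512 / 3 * (27 / (8 * Real.pi ^ 2)) * A2s * (16 * (klScale klE0 j' / klScale klE0 n)) / Real.pi * B * (72 * G ^ 2) else 0) ≤
      (c₄ * U) * (c₄ * U) * (512 / 3 * 2 * A2s * (ms / 15367) * (65 / 4) * (72 * (20 / 3) ^ 2)) := by
    split_ifs with hg
    · rw [hratio]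
      have hre : 512 / 3 * (27 / (8 * Real.pi ^ 2)) * A2s * (16 * (ms / 15367)) / Real.pi * B * (72 * G ^ 2) =
          512 / 3 * (27 / (8 * Real.pi ^ 2) * (16 / Real.pi)) * A2s * (ms / 15367) * B * (72 * G ^ 2) := by
        field_simp
      rw [hre]
      have hMM : M4 * M4 ≤ (c₄ * U) * (c₄ * U) := mul_le_mul hM4c hM4c hM4 (by positivity)
      gcongr
    · have : 0 ≤ (c₄ * U) * (c₄ * U) * (512 / 3 * 2 * A2s * (ms / 15367) * (65 / 4) * (72 * (20 / 3) ^ 2)) := by positivity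
      linarith
  -- the `η4·M4` term (n ≠ 0)
  have hT2 : (η4 * M4 + M4 * η4) * (if n = 0 then (0 : ℝ) else 512 / 3 * (27 / (8 * Real.pi ^ 2)) * A2s * (16 / Real.pi) * B * (16384 * G ^ 2)) ≤
      (2 * ((e₄ * U * (ms * ((4 : ℝ) ^ n)⁻¹ / 32)) * (c₄ * U))) * (512 / 3 * 2 * A2s * (65 / 4) * (16384 * (20 / 3) ^ 2)) := by
    rw [if_neg (by omega)]
    have hre : 512 / 3 * (27 / (8 * Real.pi ^ 2)) * A2s * (16 / Real.pi) * B * (16384 * G ^ 2) =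
        512 / 3 * (27 / (8 * Real.pi ^ 2) * (16 / Real.pi)) * A2s * B * (16384 * G ^ 2) := by ring
    rw [hre]
    have hηM : η4 * M4 + M4 * η4 ≤ 2 * ((e₄ * U * (ms * ((4 : ℝ) ^ n)⁻¹ / 32)) * (c₄ * U)) := by
      have := mul_le_mul hη4e hM4c hM4 (by positivity)
      linarith [mul_comm η4 M4]
    have h0 : 0 ≤ η4 * M4 + M4 * η4 := by positivity
    gcongr
  -- the slot from below: `Pref ≥ 3r/2`
  have hP : 3 / 2 * r ≤ klIdxPrefactor r (n + 1) := klbd_three_halves_le_klIdxPrefactor_succ hr n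
  have hslot : 9 / 20 * (θ * (r * P.Klam ^ 2)) * (U ^ 2 * ms) ≤ 2⁻¹ * (θ * (3 / 5 * (klIdxPrefactor r (n + 1) * ((P.Klam * U) ^ 2 * ms)))) := by
    have h1 : 0 ≤ θ * (P.Klam ^ 2 * (U ^ 2 * ms)) := by positivity
    have h2 := mul_le_mul_of_nonneg_left hP h1
    linarith
  -- assembly (each bound is a numeral times ONE monomial)
  have hXa : 0 ≤ A2s * c₄ ^ 2 * (U ^ 2 * ms) := by positivity
  have hXb : 0 ≤ A2s * (((4 : ℝ) ^ n)⁻¹ * (e₄ * c₄)) * (U ^ 2 * ms) := by positivity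
  have ha : (c₄ * U) * (c₄ * U) * (512 / 3 * 2 * A2s * (ms / 15367) * (65 / 4) * (72 * (20 / 3) ^ 2)) ≤ A2s * (1156 * c₄ ^ 2) * (U ^ 2 * ms) := by
    linarith
  have hb : (2 * ((e₄ * U * (ms * ((4 : ℝ) ^ n)⁻¹ / 32)) * (c₄ * U))) * (512 / 3 * 2 * A2s * (65 / 4) * (16384 * (20 / 3) ^ 2)) ≤
      A2s * (2 ^ 28 * ((4 : ℝ) ^ n)⁻¹ * (e₄ * c₄)) * (U ^ 2 * ms) := by
    linarith
  have hfin := mul_le_mul_of_nonneg_right hth (show 0 ≤ U ^ 2 * ms by positivity)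
  linarith [hT1, hT2, ha, hb, hfin, hslot]

/-- (B2) at `n = 0`: both coefficients vanish; the row is the slot's nonnegativity. -/
theorem klbd_scalarRow_direct_zero (P : SplitConsts) (R : RenConsts) {A2s M4 η4 U β θ r : ℝ} {L : ℕ} {n j' : ℕ} (hn : n = 0) (hθ : 0 ≤ θ) (hr : 0 ≤ r) :
    (M4 * M4 * (if 1 ≤ n ∧ n + 2 ≤ j' then 512 / 3 * (27 / (8 * Real.pi ^ 2)) * A2s * (16 * (klScale klE0 j' / klScale klE0 n)) / Real.pi * (10 + 50 * (4 + 8 / 3 * R.Gfr 1 * U ^ 2) * β / L) * (72 * (4 + 8 / 3 * R.Gfr 1 * U ^ 2) ^ 2) else 0) + (η4 * M4 + M4 * η4) * (if n = 0 then (0 : ℝ) else 512 / 3 * (27 / (8 * Real.pi ^ 2)) * A2s * (16 / Real.pi) * (10 + 50 * (4 + 8 / 3 * R.Gfr 1 * U ^ 2) * β / L) * (16384 * (4 + 8 / 3 * R.Gfr 1 * U ^ 2) ^ 2))) ≤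
      2⁻¹ * (θ * (3 / 5 * (klIdxPrefactor r (n + 1) * ((P.Klam * U) ^ 2 * klIdxMass n j')))) := by
  subst hn
  rw [if_neg (by omega), if_pos rfl, mul_zero, mul_zero, add_zero]
  have := klIdxPrefactor_nonneg hr (0 + 1)
  have := klIdxMass_nonneg 0 j'
  positivity

/-! ## §3 (B3): the crossed channel -/

set_option maxHeartbeats 800000 in -- two guarded products bounded factor by factor, then a linear assembly
/-- **`klbd_scalarRow_crossed_of_sizes`** — row 87's scalar row (B3) from the same size hypotheses and ONE threshold row
`A2s·(2712·c₄² + 2²⁷·4⁻ⁿ·e₄c₄) ≤ (9/20)·θ·r·Klam²` (every `1 ≤ n`, `n+1 ≤ j′`; the crossed guard `… ∧ n+3 ≤ n_β` is handled by cases). -/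
theorem klbd_scalarRow_crossed_of_sizes (P : SplitConsts) (R : RenConsts) (hGfr : 0 ≤ R.Gfr 1) {A2s M4 η4 U β θ r c₄ e₄ : ℝ} {L : ℕ} [NeZero L] {n j' : ℕ}
    (hn : 1 ≤ n) (hj : n + 1 ≤ j') (hA2s : 0 ≤ A2s) (hU : 0 ≤ U) (hβ : 0 ≤ β) (hθ : 0 ≤ θ) (hr : 0 ≤ r) (hc₄ : 0 ≤ c₄) (he₄ : 0 ≤ e₄)
    (hM4 : 0 ≤ M4) (hM4c : M4 ≤ c₄ * U) (hη4 : 0 ≤ η4) (hη4e : η4 ≤ e₄ * U * (klScale klE0 (n + 1) * klIdxMass (n + 1) j'))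
    (hGU : R.Gfr 1 * U ^ 2 ≤ 1) (hGL : 8 * (4 + 8 / 3 * R.Gfr 1 * U ^ 2) * β ≤ L)
    (hth : A2s * (2712 * c₄ ^ 2 + 2 ^ 27 * ((4 : ℝ) ^ n)⁻¹ * (e₄ * c₄)) ≤ 9 / 20 * (θ * (r * P.Klam ^ 2))) :
    (M4 * M4 * (if 1 ≤ n ∧ n + 2 ≤ j' ∧ n + 3 ≤ nScales β then 256 / 3 * (27 / (8 * Real.pi ^ 2)) * A2s * (16 * (klScale klE0 j' / klScale klE0 n)) / Real.pi * (10 + 50 * (4 + 8 / 3 * R.Gfr 1 * U ^ 2) * β / L) * (338 * (4 + 8 / 3 * R.Gfr 1 * U ^ 2) ^ 2) else 0) + (η4 * M4 + M4 * η4) * (if n = 0 then (0 : ℝ) else 256 / 3 * (27 / (8 * Real.pi ^ 2)) * A2s * (16 / Real.pi) * (10 + 50 * (4 + 8 / 3 * R.Gfr 1 * U ^ 2) * β / L) * (16384 * (4 + 8 / 3 * R.Gfr 1 * U ^ 2) ^ 2))) ≤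
      2⁻¹ * (θ * (3 / 5 * (klIdxPrefactor r (n + 1) * ((P.Klam * U) ^ 2 * klIdxMass n j')))) := by
  obtain ⟨hG4, hG, hB⟩ := klbd_regime_numbers hGfr hGU hGL
  set G : ℝ := 4 + 8 / 3 * R.Gfr 1 * U ^ 2 with hGdef
  set B : ℝ := 10 + 50 * G * β / L with hBdef
  set ms : ℝ := klIdxMass n j' with hms
  have hms0 : 0 ≤ ms := klIdxMass_nonneg n j'
  have hκ := klbd_angular_numeral_le_two
  have hπ0 : (0 : ℝ) < Real.pi := Real.pi_pos
  have hκ0 : 0 ≤ 27 / (8 * Real.pi ^ 2) * (16 / Real.pi) := by positivity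
  have hG0 : 0 ≤ G := by linarith
  have hB0 : 0 ≤ B := by
    have hL0 : (0 : ℝ) ≤ L := Nat.cast_nonneg L
    have : 0 ≤ 50 * G * β / L := by positivity
    rw [hBdef]; linarith
  have hG2 : G ^ 2 ≤ (20 / 3) ^ 2 := pow_le_pow_left₀ hG0 hG 2
  have hratio : klScale klE0 j' / klScale klE0 n = ms / 15367 := klbd_klScale_div_eq_klIdxMass (by omega)
  have hκD : klScale klE0 (n + 1) * klIdxMass (n + 1) j' = ms * ((4 : ℝ) ^ n)⁻¹ / 32 := klbd_kappaD_sq_eq hj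
  have h4n : 0 ≤ ((4 : ℝ) ^ n)⁻¹ := by positivity
  rw [hκD] at hη4e
  have hT1 : M4 * M4 * (if 1 ≤ n ∧ n + 2 ≤ j' ∧ n + 3 ≤ nScales β then 256 / 3 * (27 / (8 * Real.pi ^ 2)) * A2s * (16 * (klScale klE0 j' / klScale klE0 n)) / Real.pi * B * (338 * G ^ 2) else 0) ≤
      (c₄ * U) * (c₄ * U) * (256 / 3 * 2 * A2s * (ms / 15367) * (65 / 4) * (338 * (20 / 3) ^ 2)) := by
    split_ifs with hg
    · rw [hratio]
      have hre : 256 / 3 * (27 / (8 * Real.pi ^ 2)) * A2s * (16 * (ms / 15367)) / Real.pi * B * (338 * G ^ 2) =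
          256 / 3 * (27 / (8 * Real.pi ^ 2) * (16 / Real.pi)) * A2s * (ms / 15367) * B * (338 * G ^ 2) := by
        field_simp
      rw [hre]
      have hMM : M4 * M4 ≤ (c₄ * U) * (c₄ * U) := mul_le_mul hM4c hM4c hM4 (by positivity)
      gcongr
    · have : 0 ≤ (c₄ * U) * (c₄ * U) * (256 / 3 * 2 * A2s * (ms / 15367) * (65 / 4) * (338 * (20 / 3) ^ 2)) := by positivity
      linarith
  have hT2 : (η4 * M4 + M4 * η4) * (if n = 0 then (0 : ℝ) else 256 / 3 * (27 / (8 * Real.pi ^ 2)) * A2s * (16 / Real.pi) * B * (16384 * G ^ 2)) ≤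
      (2 * ((e₄ * U * (ms * ((4 : ℝ) ^ n)⁻¹ / 32)) * (c₄ * U))) * (256 / 3 * 2 * A2s * (65 / 4) * (16384 * (20 / 3) ^ 2)) := by
    rw [if_neg (by omega)]
    have hre : 256 / 3 * (27 / (8 * Real.pi ^ 2)) * A2s * (16 / Real.pi) * B * (16384 * G ^ 2) =
        256 / 3 * (27 / (8 * Real.pi ^ 2) * (16 / Real.pi)) * A2s * B * (16384 * G ^ 2) := by ring
    rw [hre]
    have hηM : η4 * M4 + M4 * η4 ≤ 2 * ((e₄ * U * (ms * ((4 : ℝ) ^ n)⁻¹ / 32)) * (c₄ * U)) := by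
      have := mul_le_mul hη4e hM4c hM4 (by positivity)
      linarith [mul_comm η4 M4]
    have h0 : 0 ≤ η4 * M4 + M4 * η4 := by positivity
    gcongr
  have hP : 3 / 2 * r ≤ klIdxPrefactor r (n + 1) := klbd_three_halves_le_klIdxPrefactor_succ hr n
  have hslot : 9 / 20 * (θ * (r * P.Klam ^ 2)) * (U ^ 2 * ms) ≤ 2⁻¹ * (θ * (3 / 5 * (klIdxPrefactor r (n + 1) * ((P.Klam * U) ^ 2 * ms)))) := by
    have h1 : 0 ≤ θ * (P.Klam ^ 2 * (U ^ 2 * ms)) := by positivity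
    have h2 := mul_le_mul_of_nonneg_left hP h1
    linarith
  have hXa : 0 ≤ A2s * c₄ ^ 2 * (U ^ 2 * ms) := by positivity
  have hXb : 0 ≤ A2s * (((4 : ℝ) ^ n)⁻¹ * (e₄ * c₄)) * (U ^ 2 * ms) := by positivity
  have ha : (c₄ * U) * (c₄ * U) * (256 / 3 * 2 * A2s * (ms / 15367) * (65 / 4) * (338 * (20 / 3) ^ 2)) ≤ A2s * (2712 * c₄ ^ 2) * (U ^ 2 * ms) := by
    linarith
  have hb : (2 * ((e₄ * U * (ms * ((4 : ℝ) ^ n)⁻¹ / 32)) * (c₄ * U))) * (256 / 3 * 2 * A2s * (65 / 4) * (16384 * (20 / 3) ^ 2)) ≤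
      A2s * (2 ^ 27 * ((4 : ℝ) ^ n)⁻¹ * (e₄ * c₄)) * (U ^ 2 * ms) := by
    linarith
  have hfin := mul_le_mul_of_nonneg_right hth (show 0 ≤ U ^ 2 * ms by positivity)
  linarith [hT1, hT2, ha, hb, hfin, hslot]

/-- (B3) at `n = 0`: both coefficients vanish. -/
theorem klbd_scalarRow_crossed_zero (P : SplitConsts) (R : RenConsts) {A2s M4 η4 U β θ r : ℝ} {L : ℕ} {n j' : ℕ} (hn : n = 0) (hθ : 0 ≤ θ) (hr : 0 ≤ r) :
    (M4 * M4 * (if 1 ≤ n ∧ n + 2 ≤ j' ∧ n + 3 ≤ nScales β then 256 / 3 * (27 / (8 * Real.pi ^ 2)) * A2s * (16 * (klScale klE0 j' / klScale klE0 n)) / Real.pi * (10 + 50 * (4 + 8 / 3 * R.Gfr 1 * U ^ 2) * β / L) * (338 * (4 + 8 / 3 * R.Gfr 1 * U ^ 2) ^ 2) else 0) + (η4 * M4 + M4 * η4) * (if n = 0 then (0 : ℝ) else 256 / 3 * (27 / (8 * Real.pi ^ 2)) * A2s * (16 / Real.pi) * (10 + 50 * (4 + 8 / 3 * R.Gfr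 1 * U ^ 2) * β / L) * (16384 * (4 + 8 / 3 * R.Gfr 1 * U ^ 2) ^ 2))) ≤
      2⁻¹ * (θ * (3 / 5 * (klIdxPrefactor r (n + 1) * ((P.Klam * U) ^ 2 * klIdxMass n j')))) := by
  subst hn
  rw [if_neg (by omega), if_pos rfl, mul_zero, mul_zero, add_zero]
  have := klIdxPrefactor_nonneg hr (0 + 1)
  have := klIdxMass_nonneg 0 j'
  positivity

end ScalarRows

end Summit.HubbardSuperconductivity.HubbardSuperconductivity.Theorems.KLRegimeSplit

end
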